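import Summits.PneNP.PneNP.Theorems.ChebyshevTracialDesignGammaDirectionNumericsAWeights
import Summits.PneNP.PneNP.Theorems.ChebyshevTracialDesignGammaDirectionNumericsBC
import HarnessLib

/-!
# Cell pnp-psdrank, route `ChebyshevTracialDesign`: the γ-direction numerics for brick 130's input (ii) — `ε_A ≤ ½` for `P ≥ P*`
# (crux `TracialDecayExp20`, stmt-PneNP-19878)

Brick 140d, part 2 (eng g26; MEMO-30 §4 «126b-type numerics»; prover g28's brick 139
`…GammaDirectionSecondMomentRelative.sum_abs_fwdDiff_centredSecond_le_rel` delivers brick 130's `(hA)` as `Σ_{k=1}^{D} c_k|Δ^kA^m(0)| ≤ ε_A·A^m_1(x)`,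
`ε_A = (E·R/4 + 1/(r+1)) + (λ₁+λ₂)/V + ((μ₁ + D(4/3)^D·μ₂)τ + φ·Far)/(LB·V)` — «numerics not done»). With the weights of part 1
(`…GammaDirectionNumericsAWeights`), every structural quantity entering through its scale only — `E ≤ c_E/P⁵` (level-`1` x-smoothness constant
at `L ≍ P⁵`), `Γ ≤ c_Γ·P`, `q ≤ c_q/P⁶` (brick 140a), `a ≤ P⁸` (`a ≤ N₀`), `P⁸/4 ≤ 2r+6` and `8(r+2) ≤ 5P⁸` (balanced cut), `n = 2P⁸`,
`c_r²P⁸ ≤ V` ((V): `V = r_V²/2`, `r_V ≍ β√N₀`), `τ, D(4/3)^Dτ ≤ LB/(2P³²)` (brick 140c), `Far ≤ 4τ` (`exp_far_mono`):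
* **`epsA_numerics`**: `∃ P* ∀ P ≥ P*`: brick 139's `ε_A` (VERBATIM in its variables, `a r n` real, `D` natural) is `≤ ½`
  (`ε_A ≤ K_A/P`, `K_A = 8c_E + 16 + (K_λ + 1605)/c_r²`, `P* = 2 + 2K_A`); with brick 140b (`ε_B, ε_C ≤ ¼`) brick 130's `ε_A + ε_B ≤ 1`, `ε_C + ε_B ≤ 1` hold;
* `xSmoothConst_le`: the constant of brick 139's `hE` (brick 124's level-`1` `E₁` at `N₀−2`, length `L`) is `≤ c_E/P⁵`,
  `c_E = 4(c_η + c_Q')²(1 + 8c_Q'/3)`, `c_Q' = 2√192·√(48/((β²/8)⁴β))`, under `L + 2 ≤ c_L P⁵`, `P⁸/4 ≤ N₀−2 ≤ P⁸`, `c_η ≤ P³` (brick 140c's outputs);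
* `epsBC_numerics_nat`: brick 140b restated with `D` natural (`(4/3)^D` a monoid power, as in brick 137's `ε_B`), via `Real.rpow_natCast`.
Pure real arithmetic (both parts pass at `maxHeartbeats 100000`). WHAT THIS FILE DOES NOT DO: choose `L, R, ε, r_V`, anything combinatorial,
anything on `TracialDecayExp20` itself, psd rank of P_PM(K_n), or P vs NP. [cite: RollinRoss2010, §4.1 Thm 4.2 (the variance scale)] [cite: Agarwal2000DifferenceEquations, Remark 1.8.1]
Stature: support/instrument (kernel lane, no defs, axioms standard). Supports stmt-PneNP-19878.
-/

set_option linter.dupNamespace false -- `Summit.PneNP.PneNP.…`: summit = sub-problem (D-0017)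

noncomputable section

namespace Summit.PneNP.PneNP.Theorems.ChebyshevTracialDesignGammaDirectionNumericsA

open Summit.PneNP.PneNP.Theorems.ChebyshevTracialDesignGammaDirectionNumericsBC (epsBC_numerics)
open Summit.PneNP.PneNP.Theorems.ChebyshevTracialDesignGammaDirectionNumericsAWeights (lambda_le alpha_le far_le)

/-! ### §1 The threshold -/

/-- Scale identities for `epsA_numerics` (kept out of the big context). [cite: RollinRoss2010, §4.1 Thm 4.2 (the variance scale)] -/
theorem scale_ids {Kl cr P LB cE KA : ℝ} (hP : 0 < P) (hcr : 0 < cr) (hLB : 0 < LB) (hKA : KA = 8 * cE + 16 + (Kl + 1605) / cr ^ 2) :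
    Kl * P ^ 7 / (cr ^ 2 * P ^ 8) = Kl / (cr ^ 2 * P) ∧
    (1605 * LB / P ^ 16) / (LB * (cr ^ 2 * P ^ 8)) = 1605 / (cr ^ 2 * P ^ 24) ∧
    P ^ 16 * (LB / (2 * P ^ 32)) = LB / (2 * P ^ 16) ∧
    (1605 : ℝ) * LB / P ^ 16 = 3210 * (LB / (2 * P ^ 16)) ∧
    (8 * cE + 16) / P + Kl / (cr ^ 2 * P) + 1605 / (cr ^ 2 * P) = KA / P := by
  have hP' : P ≠ 0 := hP.ne'
  have hcr' : cr ≠ 0 := hcr.ne'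
  have hLB' : LB ≠ 0 := hLB.ne'
  refine ⟨?_, ?_, ?_, ?_, ?_⟩
  · rw [div_eq_div_iff (by positivity) (by positivity)]; ring
  · rw [div_div, div_eq_div_iff (by positivity) (by positivity)]; ring
  · rw [eq_div_iff (by positivity)]; field_simp
  · rw [eq_comm, mul_div_assoc', div_eq_div_iff (by positivity) (by positivity)]; ring
  · rw [hKA, eq_div_iff hP']; field_simp; ring


/-- **`ε_A ≤ ½` for `P ≥ P*`.** For `c_E, c_Γ, c_q ≥ 0`, `c_r > 0` there is `P* ≥ 0` such that for `P ≥ P*` (`1 ≤ P`), every natural `D ≥ 1` with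
`D ≤ 2P²`, and all reals `E, Γ, q, a, r, n, V, LB, τ, Far` in the γ-direction's scale — `E ≤ c_E/P⁵` (the level-`1` x-smoothness constant),
`0 ≤ Γ ≤ c_Γ P`, `0 ≤ q ≤ c_q/P⁶` (brick 140a), `0 ≤ a ≤ P⁸` (`a ≤ N₀`), `0 ≤ r`, `P⁸/4 ≤ 2r+6`, `8(r+2) ≤ 5P⁸` (the balanced cut
`n/4 ≤ 2r+7`, `8(r+2) ≤ (4+β)(N₀−2)`), `n = 2P⁸`, `c_r²P⁸ ≤ V` ((V)), `0 < LB`, `0 ≤ τ ≤ LB/(2P³²)`, `D(4/3)^Dτ ≤ LB/(2P³²)` (brick 140c's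
far-term budget), `0 ≤ Far ≤ 4τ` (`exp_far_mono`) — brick 139's `ε_A` (written VERBATIM in its variables) is at most `½`.
With brick 140b (`ε_B, ε_C ≤ ¼`) this gives brick 130's `ε_A + ε_B ≤ 1`, `ε_C + ε_B ≤ 1`.
[cite: RollinRoss2010, §4.1 Thm 4.2 (the variance scale)] [cite: Agarwal2000DifferenceEquations, Remark 1.8.1] -/
theorem epsA_numerics {cE cΓ cq cr : ℝ} (hcE : 0 ≤ cE) (hcΓ : 0 ≤ cΓ) (hcq : 0 ≤ cq) (hcr : 0 < cr) :
    ∃ Pstar : ℝ, 0 ≤ Pstar ∧ ∀ P : ℝ, Pstar ≤ P → 1 ≤ P →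
      ∀ (D : ℕ) (E Γ q a r n V LB τ Far : ℝ), 1 ≤ D → (D : ℝ) ≤ 2 * P ^ 2 →
        E ≤ cE / P ^ 5 → 0 ≤ Γ → Γ ≤ cΓ * P → 0 ≤ q → q ≤ cq / P ^ 6 → 0 ≤ a → a ≤ P ^ 8 →
        0 ≤ r → P ^ 8 / 4 ≤ 2 * r + 6 → 8 * (r + 2) ≤ 5 * P ^ 8 → n = 2 * P ^ 8 →
        cr ^ 2 * P ^ 8 ≤ V → 0 < LB → 0 ≤ τ → τ ≤ LB / (2 * P ^ 32) → (D : ℝ) * (4 / 3 : ℝ) ^ D * τ ≤ LB / (2 * P ^ 32) →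
        0 ≤ Far → Far ≤ 4 * τ →
      ((E * (n * (n - 2) / ((2 * r + 6) * (n - 2 * r - 8))) / 4 + 1 / (r + 1)) +
          ((E * (n * (n - 2) / ((2 * r + 6) * (n - 2 * r - 8))) / 4 * (2 * a ^ 2 / (r + 1) + (2 * a + 1) * a / (r + 2)) +
            (2 * a + 1) * (r + 3) / (2 * (r + 2) * (r + 1)) *
              (a * (4 * Γ * q + (2 + 4 * Γ * q) / (2 * r + 6))) +
            a * (2 * a + r + 3) / (2 * (r + 2) * (r + 1)) * (1 + 2 * Γ * q)) +
            (D : ℝ) * (2 * Γ * q ^ 2 * a ^ 2 + 8 * (D : ℝ) * Γ * q * a ^ 2 / (2 * r + 6) +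
            32 * (D : ℝ) ^ 2 * Γ * a ^ 2 / ((2 * r + 6) * (2 * r + 4)) +
            (2 * a + 1) * a * (Γ * q ^ 2 + 4 * (D : ℝ) * Γ * q / (2 * r + 6)))) / V +
          ((((2 * a + 1) * (r + 3) / (2 * (r + 2) * (r + 1)) * (16 * a / 3) +
            a * (2 * a + r + 3) / (2 * (r + 2) * (r + 1)) * (8 / 3)) +
              (D : ℝ) * (4 / 3 : ℝ) ^ D *
            (a ^ 2 * ((2 * r + 6) * (2 * r + 4) / (n * (n - 2)) + 8 * (D : ℝ) * (2 * r + 4) / (n * (n - 2)) +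
                32 * (D : ℝ) ^ 2 / (n * (n - 2)) + 1) +
              (2 * a + 1) * a * ((2 * r + 6 + 4 * (D : ℝ)) / n))) * τ +
            (((r + 2 + a) ^ 2 + 2 * (r + 2) ^ 2 / (r + 1) + (2 * a + 1)) / 4) * Far) / (LB * V)) ≤ 1 / 2 := by
  obtain ⟨Kl, hKl⟩ : ∃ c : ℝ, c = 640 * cE + 8768 * cΓ * cq + 3456 + 10 * cΓ * cq ^ 2 + 8192 * cΓ := ⟨_, rfl⟩
  obtain ⟨KA, hKA⟩ : ∃ c : ℝ, c = 8 * cE + 16 + (Kl + 1605) / cr ^ 2 := ⟨_, rfl⟩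
  have hKl0 : 0 ≤ Kl := by rw [hKl]; positivity
  have hKA0 : 0 ≤ KA := by rw [hKA]; positivity
  refine ⟨2 + 2 * KA, by positivity, ?_⟩
  intro P hPstar hP1 D E Γ q a r n V LB τ Far hD1 hD hE hΓ0 hΓ hq0 hq ha0 ha hr0 hr6 hr58 hn hV hLB hτ0 hτ hDτ hFar0 hFar
  have hP0 : 0 < P := by linarith
  have hP2 : 2 ≤ P := by linarith
  have hPKA : 2 * KA ≤ P := by linarith
  obtain ⟨id1, id2, id3, id4, id5⟩ := scale_ids (Kl := Kl) hP0 hcr hLB hKA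
  -- the scale `Y = P⁸ ≥ 256`
  have hY256 : (256 : ℝ) ≤ P ^ 8 := by
    have := pow_le_pow_left₀ (by norm_num : (0 : ℝ) ≤ 2) hP2 8
    norm_num at this; exact this
  have hY1 : (1 : ℝ) ≤ P ^ 8 := one_le_pow₀ hP1
  have hYpos : (0 : ℝ) < P ^ 8 := by positivity
  -- the slot hypotheses
  have h2a1 : 2 * a + 1 ≤ 3 * P ^ 8 := by linarith
  have hr1 : P ^ 8 / 16 ≤ r + 1 := by linarith
  have hr2 : P ^ 8 / 16 ≤ r + 2 := by linarith
  have hr4 : P ^ 8 / 8 ≤ 2 * r + 4 := by linarith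
  have hr3 : r + 3 ≤ P ^ 8 := by linarith
  have hr2Y : r + 2 ≤ P ^ 8 := by linarith
  have h2ar : 2 * a + r + 3 ≤ 3 * P ^ 8 := by linarith
  have hra : r + 2 + a ≤ 2 * P ^ 8 := by linarith
  have hn0 : 0 ≤ n := by rw [hn]; positivity
  have hnle : n ≤ 2 * P ^ 8 := le_of_eq hn
  have hnge : 2 * P ^ 8 ≤ n := ge_of_eq hn
  have hn2 : n - 2 ≤ 2 * P ^ 8 := by linarith
  have hn2' : 0 ≤ n - 2 := by linarith
  have hnY : P ^ 8 ≤ n - 2 := by linarith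
  have hnr : P ^ 8 / 2 ≤ n - 2 * r - 8 := by linarith
  have h2r6 : 2 * r + 6 ≤ 2 * P ^ 8 := by linarith
  have h2r4 : 2 * r + 4 ≤ 2 * P ^ 8 := by linarith
  have hrD : 2 * r + 6 + 4 * (D : ℝ) ≤ 2 * P ^ 8 + 4 * (2 * P ^ 2) := by linarith
  have hV0 : 0 < V := lt_of_lt_of_le (by positivity) hV
  have hP5 : P ≤ P ^ 5 := le_self_pow₀ hP1 (by norm_num)
  have hP8' : P ≤ P ^ 8 := le_self_pow₀ hP1 (by norm_num)
  have hP24 : P ≤ P ^ 24 := le_self_pow₀ hP1 (by norm_num)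
  have hcr2 : 0 ≤ cr ^ 2 := by positivity
  have hcrP : 0 < cr ^ 2 * P := by positivity
  have hcrP8 : 0 < cr ^ 2 * P ^ 8 := by positivity
  have hL0 : 0 ≤ Kl * P ^ 7 := by positivity
  have hF1 : 0 ≤ 1605 * LB / P ^ 16 := by positivity
  have h8cE : (0 : ℝ) ≤ 8 * cE := by positivity
  have hLBV : 0 < LB * V := mul_pos hLB hV0
  have hLBcr : 0 < LB * (cr ^ 2 * P ^ 8) := by positivity
  -- the three parts
  have hA := alpha_le hP1 hE hcE hr0 hr1 hr6 hn0 hnle hn2 hn2' hnr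
  have hL := lambda_le (D := D) hP1 hE ha0 ha h2a1 hr0 hr1 hr2 hr6 hr4 hr3 h2ar hn0 hnle hn2 hn2' hnr hΓ0 hΓ hq0 hq hD hcE hcΓ hcq
  rw [← hKl] at hL
  -- the far numerator
  have hF := far_le (D := D) hP1 ha0 ha h2a1 hr0 hr1 hr2 hr3 h2ar hr2Y hra h2r6 h2r4 hnge hnY hD hrD hLB hτ0 hτ hDτ hFar0 hFar
  -- divide
  have hLV : ((E * (n * (n - 2) / ((2 * r + 6) * (n - 2 * r - 8))) / 4 * (2 * a ^ 2 / (r + 1) + (2 * a + 1) * a / (r + 2)) +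
            (2 * a + 1) * (r + 3) / (2 * (r + 2) * (r + 1)) *
              (a * (4 * Γ * q + (2 + 4 * Γ * q) / (2 * r + 6))) +
            a * (2 * a + r + 3) / (2 * (r + 2) * (r + 1)) * (1 + 2 * Γ * q)) +
            (D : ℝ) * (2 * Γ * q ^ 2 * a ^ 2 + 8 * (D : ℝ) * Γ * q * a ^ 2 / (2 * r + 6) +
            32 * (D : ℝ) ^ 2 * Γ * a ^ 2 / ((2 * r + 6) * (2 * r + 4)) +
            (2 * a + 1) * a * (Γ * q ^ 2 + 4 * (D : ℝ) * Γ * q / (2 * r + 6)))) / V ≤ Kl / (cr ^ 2 * P) := by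
    calc ((E * (n * (n - 2) / ((2 * r + 6) * (n - 2 * r - 8))) / 4 * (2 * a ^ 2 / (r + 1) + (2 * a + 1) * a / (r + 2)) +
            (2 * a + 1) * (r + 3) / (2 * (r + 2) * (r + 1)) *
              (a * (4 * Γ * q + (2 + 4 * Γ * q) / (2 * r + 6))) +
            a * (2 * a + r + 3) / (2 * (r + 2) * (r + 1)) * (1 + 2 * Γ * q)) +
            (D : ℝ) * (2 * Γ * q ^ 2 * a ^ 2 + 8 * (D : ℝ) * Γ * q * a ^ 2 / (2 * r + 6) +
            32 * (D : ℝ) ^ 2 * Γ * a ^ 2 / ((2 * r + 6) * (2 * r + 4)) +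
            (2 * a + 1) * a * (Γ * q ^ 2 + 4 * (D : ℝ) * Γ * q / (2 * r + 6)))) / V ≤ Kl * P ^ 7 / V := div_le_div_of_nonneg_right hL hV0.le
      _ ≤ Kl * P ^ 7 / (cr ^ 2 * P ^ 8) := div_le_div_of_nonneg_left hL0 hcrP8 hV
      _ = Kl / (cr ^ 2 * P) := id1
  have hFV : (((2 * a + 1) * (r + 3) / (2 * (r + 2) * (r + 1)) * (16 * a / 3) + a * (2 * a + r + 3) / (2 * (r + 2) * (r + 1)) * (8 / 3) +
              (D : ℝ) * (4 / 3 : ℝ) ^ D *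
            (a ^ 2 * ((2 * r + 6) * (2 * r + 4) / (n * (n - 2)) + 8 * (D : ℝ) * (2 * r + 4) / (n * (n - 2)) +
                32 * (D : ℝ) ^ 2 / (n * (n - 2)) + 1) +
              (2 * a + 1) * a * ((2 * r + 6 + 4 * (D : ℝ)) / n))) * τ +
            (((r + 2 + a) ^ 2 + 2 * (r + 2) ^ 2 / (r + 1) + (2 * a + 1)) / 4) * Far) / (LB * V) ≤ 1605 / (cr ^ 2 * P) := by
    calc (((2 * a + 1) * (r + 3) / (2 * (r + 2) * (r + 1)) * (16 * a / 3) + a * (2 * a + r + 3) / (2 * (r + 2) * (r + 1)) * (8 / 3) +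
              (D : ℝ) * (4 / 3 : ℝ) ^ D *
            (a ^ 2 * ((2 * r + 6) * (2 * r + 4) / (n * (n - 2)) + 8 * (D : ℝ) * (2 * r + 4) / (n * (n - 2)) +
                32 * (D : ℝ) ^ 2 / (n * (n - 2)) + 1) +
              (2 * a + 1) * a * ((2 * r + 6 + 4 * (D : ℝ)) / n))) * τ +
            (((r + 2 + a) ^ 2 + 2 * (r + 2) ^ 2 / (r + 1) + (2 * a + 1)) / 4) * Far) / (LB * V) ≤ (1605 * LB / P ^ 16) / (LB * V) := div_le_div_of_nonneg_right hF hLBV.le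
      _ ≤ (1605 * LB / P ^ 16) / (LB * (cr ^ 2 * P ^ 8)) :=
          div_le_div_of_nonneg_left hF1 hLBcr (mul_le_mul_of_nonneg_left hV hLB.le)
      _ = 1605 / (cr ^ 2 * P ^ 24) := id2
      _ ≤ 1605 / (cr ^ 2 * P) := div_le_div_of_nonneg_left (by norm_num) hcrP (mul_le_mul_of_nonneg_left hP24 hcr2)
  have hA' : (E * (n * (n - 2) / ((2 * r + 6) * (n - 2 * r - 8))) / 4 + 1 / (r + 1)) ≤ (8 * cE + 16) / P := by
    refine hA.trans ?_
    have h1 : 8 * cE / P ^ 5 ≤ 8 * cE / P := div_le_div_of_nonneg_left h8cE hP0 hP5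
    have h2 : 16 / P ^ 8 ≤ 16 / P := div_le_div_of_nonneg_left (by norm_num) hP0 hP8'
    rw [add_div]; linarith only [h1, h2]
  -- total
  have htot : (8 * cE + 16) / P + Kl / (cr ^ 2 * P) + 1605 / (cr ^ 2 * P) = KA / P := id5
  have hfin : KA / P ≤ 1 / 2 := by
    rw [div_le_iff₀ hP0]; linarith only [hPKA]
  calc ((E * (n * (n - 2) / ((2 * r + 6) * (n - 2 * r - 8))) / 4 + 1 / (r + 1)) +
          ((E * (n * (n - 2) / ((2 * r + 6) * (n - 2 * r - 8))) / 4 * (2 * a ^ 2 / (r + 1) + (2 * a + 1) * a / (r + 2)) +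
            (2 * a + 1) * (r + 3) / (2 * (r + 2) * (r + 1)) *
              (a * (4 * Γ * q + (2 + 4 * Γ * q) / (2 * r + 6))) +
            a * (2 * a + r + 3) / (2 * (r + 2) * (r + 1)) * (1 + 2 * Γ * q)) +
            (D : ℝ) * (2 * Γ * q ^ 2 * a ^ 2 + 8 * (D : ℝ) * Γ * q * a ^ 2 / (2 * r + 6) +
            32 * (D : ℝ) ^ 2 * Γ * a ^ 2 / ((2 * r + 6) * (2 * r + 4)) +
            (2 * a + 1) * a * (Γ * q ^ 2 + 4 * (D : ℝ) * Γ * q / (2 * r + 6)))) / V +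
          ((((2 * a + 1) * (r + 3) / (2 * (r + 2) * (r + 1)) * (16 * a / 3) +
            a * (2 * a + r + 3) / (2 * (r + 2) * (r + 1)) * (8 / 3)) +
              (D : ℝ) * (4 / 3 : ℝ) ^ D *
            (a ^ 2 * ((2 * r + 6) * (2 * r + 4) / (n * (n - 2)) + 8 * (D : ℝ) * (2 * r + 4) / (n * (n - 2)) +
                32 * (D : ℝ) ^ 2 / (n * (n - 2)) + 1) +
              (2 * a + 1) * a * ((2 * r + 6 + 4 * (D : ℝ)) / n))) * τ +
            (((r + 2 + a) ^ 2 + 2 * (r + 2) ^ 2 / (r + 1) + (2 * a + 1)) / 4) * Far) / (LB * V)) = (E * (n * (n - 2) / ((2 * r + 6) * (n - 2 * r - 8))) / 4 + 1 / (r + 1)) + ((E * (n * (n - 2) / ((2 * r + 6) * (n - 2 * r - 8))) / 4 * (2 * a ^ 2 / (r + 1) + (2 * a + 1) * a / (r + 2)) +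
            (2 * a + 1) * (r + 3) / (2 * (r + 2) * (r + 1)) *
              (a * (4 * Γ * q + (2 + 4 * Γ * q) / (2 * r + 6))) +
            a * (2 * a + r + 3) / (2 * (r + 2) * (r + 1)) * (1 + 2 * Γ * q)) +
            (D : ℝ) * (2 * Γ * q ^ 2 * a ^ 2 + 8 * (D : ℝ) * Γ * q * a ^ 2 / (2 * r + 6) +
            32 * (D : ℝ) ^ 2 * Γ * a ^ 2 / ((2 * r + 6) * (2 * r + 4)) +
            (2 * a + 1) * a * (Γ * q ^ 2 + 4 * (D : ℝ) * Γ * q / (2 * r + 6)))) / V + (((2 * a + 1) * (r + 3) / (2 * (r + 2) * (r + 1)) * (16 * a / 3) + a * (2 * a + r + 3) / (2 * (r + 2) * (r + 1)) * (8 / 3) +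
              (D : ℝ) * (4 / 3 : ℝ) ^ D *
            (a ^ 2 * ((2 * r + 6) * (2 * r + 4) / (n * (n - 2)) + 8 * (D : ℝ) * (2 * r + 4) / (n * (n - 2)) +
                32 * (D : ℝ) ^ 2 / (n * (n - 2)) + 1) +
              (2 * a + 1) * a * ((2 * r + 6 + 4 * (D : ℝ)) / n))) * τ +
            (((r + 2 + a) ^ 2 + 2 * (r + 2) ^ 2 / (r + 1) + (2 * a + 1)) / 4) * Far) / (LB * V) := rfl
    _ ≤ (8 * cE + 16) / P + Kl / (cr ^ 2 * P) + 1605 / (cr ^ 2 * P) := by linarith only [hA', hLV, hFV]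
    _ = KA / P := htot
    _ ≤ 1 / 2 := hfin

/-! ### §2 The level-`1` x-smoothness constant `E` in the `P`-scale -/

/-- **The level-`1` x-smoothness constant in the `P`-scale.** The constant of brick 139's hypothesis `hE` (brick 124's `E₁` at `N₀−2`, `D = 1`, length
`L`), written verbatim with `N₀` real: for `0 < β`, `1 ≤ P`, `0 ≤ L`, `L + 2 ≤ c_L·P⁵`, `P⁸/4 ≤ N₀ − 2 ≤ P⁸` and `c_η := 32c_L/((β²/8)⁴β) ≤ P³`
it is at most `c_E/P⁶ ≤ c_E/P⁵`, `c_E = 4(c_η + c_Q')²(1 + 8c_Q'/3)`, `c_Q' = 2√192·√(48/((β²/8)⁴β))`.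
[cite: RollinRoss2010, §4.1 Thm 4.2 (the variance scale)] -/
theorem xSmoothConst_le {β P L N₀ cL : ℝ} (hβ : 0 < β) (hP1 : 1 ≤ P) (hL0 : 0 ≤ L) (hcL : 0 ≤ cL) (hL : L + 2 ≤ cL * P ^ 5)
    (hNlo : P ^ 8 / 4 ≤ N₀ - 2) (hNhi : N₀ - 2 ≤ P ^ 8) (hPη : 32 * cL / ((β ^ 2 / 8) ^ 4 * β) ≤ P ^ 3) :
    (((1 + 8 * (L + 1 + 1) / ((β ^ 2 / 8) ^ 4 * (β * (N₀ - 2)))) *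
            (8 * (L + 1 + 1) / ((β ^ 2 / 8) ^ 4 * (β * (N₀ - 2))) +
              2 * Real.sqrt 192 * Real.sqrt (2 * (2 * (1 : ℝ) + 1) *
                (1 + 8 * (L + 1 + 1) / ((β ^ 2 / 8) ^ 4 * (β * (N₀ - 2)))) /
                  ((β ^ 2 / 8) ^ 4 * (β * (N₀ - 2)))))) ^ (2 * 1) *
          (1 + 4 * (Real.sqrt (N₀ - 2) + 1) / 3 *
            (2 * Real.sqrt 192 * Real.sqrt (2 * (2 * (1 : ℝ) + 1) *
              (1 + 8 * (L + 1 + 1) / ((β ^ 2 / 8) ^ 4 * (β * (N₀ - 2)))) /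
                ((β ^ 2 / 8) ^ 4 * (β * (N₀ - 2))))))) ≤
      4 * (32 * cL / ((β ^ 2 / 8) ^ 4 * β) + 2 * Real.sqrt 192 * Real.sqrt (48 / ((β ^ 2 / 8) ^ 4 * β))) ^ 2 *
        (1 + 8 * (2 * Real.sqrt 192 * Real.sqrt (48 / ((β ^ 2 / 8) ^ 4 * β))) / 3) / P ^ 5 := by
  obtain ⟨cη, hcη⟩ : ∃ c : ℝ, c = 32 * cL / ((β ^ 2 / 8) ^ 4 * β) := ⟨_, rfl⟩
  obtain ⟨cQ, hcQ⟩ : ∃ c : ℝ, c = 2 * Real.sqrt 192 * Real.sqrt (48 / ((β ^ 2 / 8) ^ 4 * β)) := ⟨_, rfl⟩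
  obtain ⟨ηx, hηx⟩ : ∃ e : ℝ, e = 8 * (L + 1 + 1) / ((β ^ 2 / 8) ^ 4 * (β * (N₀ - 2))) := ⟨_, rfl⟩
  rw [← hcη] at hPη ⊢
  rw [← hηx, ← hcQ]
  obtain ⟨Qx, hQx⟩ : ∃ e : ℝ, e = 2 * Real.sqrt 192 * Real.sqrt (2 * (2 * (1 : ℝ) + 1) * (1 + ηx) / ((β ^ 2 / 8) ^ 4 * (β * (N₀ - 2)))) :=
    ⟨_, rfl⟩
  rw [← hQx]
  have hP0 : 0 < P := by linarith
  have hP3pos : 0 < P ^ 3 := by positivity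
  have hP4pos : 0 < P ^ 4 := by positivity
  have hNpos : 0 < N₀ - 2 := lt_of_lt_of_le (by positivity) hNlo
  have hb0 : 0 < (β ^ 2 / 8) ^ 4 * β := by positivity
  have hdenpos : 0 < (β ^ 2 / 8) ^ 4 * (β * (N₀ - 2)) := by positivity
  have hden : (β ^ 2 / 8) ^ 4 * β * (P ^ 8 / 4) ≤ (β ^ 2 / 8) ^ 4 * (β * (N₀ - 2)) := by
    have := mul_le_mul_of_nonneg_left hNlo hb0.le
    linarith only [this]
  have hcη0 : 0 ≤ cη := by rw [hcη]; positivity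
  have hcQ0 : 0 ≤ cQ := by rw [hcQ]; positivity
  have hηx0 : 0 ≤ ηx := by rw [hηx]; positivity
  -- `η ≤ c_η/P³ ≤ 1`
  have hηs : ηx ≤ cη / P ^ 3 := by
    rw [hηx, div_le_div_iff₀ hdenpos hP3pos, hcη]
    have h1 : 8 * (L + 1 + 1) * P ^ 3 ≤ 8 * (cL * P ^ 5) * P ^ 3 :=
      mul_le_mul_of_nonneg_right (by linarith only [hL]) hP3pos.le
    have h2 : 32 * cL / ((β ^ 2 / 8) ^ 4 * β) * ((β ^ 2 / 8) ^ 4 * β * (P ^ 8 / 4)) = 8 * (cL * P ^ 5) * P ^ 3 := by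
      field_simp; ring
    calc 8 * (L + 1 + 1) * P ^ 3 ≤ 8 * (cL * P ^ 5) * P ^ 3 := h1
      _ = 32 * cL / ((β ^ 2 / 8) ^ 4 * β) * ((β ^ 2 / 8) ^ 4 * β * (P ^ 8 / 4)) := h2.symm
      _ ≤ 32 * cL / ((β ^ 2 / 8) ^ 4 * β) * ((β ^ 2 / 8) ^ 4 * (β * (N₀ - 2))) := mul_le_mul_of_nonneg_left hden (by positivity)
  have hη1 : ηx ≤ 1 := hηs.trans (by rw [div_le_one hP3pos]; exact hPη)
  -- `Q ≤ c_Q / P⁴ ≤ c_Q / P³`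
  have hQs4 : Qx ≤ cQ / P ^ 4 := by
    have harg : 2 * (2 * (1 : ℝ) + 1) * (1 + ηx) / ((β ^ 2 / 8) ^ 4 * (β * (N₀ - 2))) ≤ 48 / ((β ^ 2 / 8) ^ 4 * β) * (1 / P ^ 4) ^ 2 := by
      have hnum : 2 * (2 * (1 : ℝ) + 1) * (1 + ηx) ≤ 12 := by nlinarith only [hη1]
      calc _ ≤ 12 / ((β ^ 2 / 8) ^ 4 * (β * (N₀ - 2))) := div_le_div_of_nonneg_right hnum hdenpos.le
        _ ≤ 12 / ((β ^ 2 / 8) ^ 4 * β * (P ^ 8 / 4)) := div_le_div_of_nonneg_left (by norm_num) (by positivity) hden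
        _ = 48 / ((β ^ 2 / 8) ^ 4 * β) * (1 / P ^ 4) ^ 2 := by field_simp; ring
    have hs : Real.sqrt (2 * (2 * (1 : ℝ) + 1) * (1 + ηx) / ((β ^ 2 / 8) ^ 4 * (β * (N₀ - 2)))) ≤
        Real.sqrt (48 / ((β ^ 2 / 8) ^ 4 * β)) / P ^ 4 := by
      calc Real.sqrt _ ≤ Real.sqrt (48 / ((β ^ 2 / 8) ^ 4 * β) * (1 / P ^ 4) ^ 2) := Real.sqrt_le_sqrt harg
        _ = Real.sqrt (48 / ((β ^ 2 / 8) ^ 4 * β)) * (1 / P ^ 4) := by rw [Real.sqrt_mul (by positivity), Real.sqrt_sq (by positivity)]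
        _ = _ := by ring
    calc Qx = _ := hQx
      _ ≤ 2 * Real.sqrt 192 * (Real.sqrt (48 / ((β ^ 2 / 8) ^ 4 * β)) / P ^ 4) := mul_le_mul_of_nonneg_left hs (by positivity)
      _ = cQ / P ^ 4 := by rw [hcQ]; ring
  have hQs : Qx ≤ cQ / P ^ 3 := hQs4.trans (div_le_div_of_nonneg_left hcQ0 hP3pos (pow_le_pow_right₀ hP1 (by norm_num)))
  have hQs0 : 0 ≤ Qx := by rw [hQx]; positivity
  -- `Γ' ≤ 1 + 8c_Q/3`
  have hsqrtN : Real.sqrt (N₀ - 2) ≤ P ^ 4 := by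
    rw [show P ^ 4 = Real.sqrt ((P ^ 4) ^ 2) by rw [Real.sqrt_sq (by positivity)]]
    exact Real.sqrt_le_sqrt (by nlinarith only [hNhi])
  have hΓ : 1 + 4 * (Real.sqrt (N₀ - 2) + 1) / 3 * Qx ≤ 1 + 8 * cQ / 3 := by
    have hq1 : 4 * (Real.sqrt (N₀ - 2) + 1) / 3 ≤ 8 * P ^ 4 / 3 := by
      have : (1 : ℝ) ≤ P ^ 4 := one_le_pow₀ hP1
      linarith only [this, hsqrtN]
    have hq2 : 4 * (Real.sqrt (N₀ - 2) + 1) / 3 * Qx ≤ (8 * P ^ 4 / 3) * (cQ / P ^ 4) := mul_le_mul hq1 hQs4 hQs0 (by positivity)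
    have hq3 : (8 * P ^ 4 / 3) * (cQ / P ^ 4) = 8 * cQ / 3 := by field_simp
    linarith only [hq2, hq3]
  have hΓ0 : 0 ≤ 1 + 4 * (Real.sqrt (N₀ - 2) + 1) / 3 * Qx := by positivity
  -- `ρ' ≤ 2(c_η + c_Q)/P³`
  have hρ : (1 + ηx) * (ηx + Qx) ≤ 2 * ((cη + cQ) / P ^ 3) := by
    have hq1 : ηx + Qx ≤ (cη + cQ) / P ^ 3 := by rw [add_div]; exact add_le_add hηs hQs
    exact mul_le_mul (by linarith only [hη1]) hq1 (by positivity) (by norm_num)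
  have hρ0 : 0 ≤ (1 + ηx) * (ηx + Qx) := by positivity
  -- assemble
  have hsq : ((1 + ηx) * (ηx + Qx)) ^ (2 * 1) ≤ (2 * ((cη + cQ) / P ^ 3)) ^ 2 := by
    rw [show 2 * 1 = 2 from rfl]; exact pow_le_pow_left₀ hρ0 hρ 2
  calc ((1 + ηx) * (ηx + Qx)) ^ (2 * 1) * (1 + 4 * (Real.sqrt (N₀ - 2) + 1) / 3 * Qx)
      ≤ (2 * ((cη + cQ) / P ^ 3)) ^ 2 * (1 + 8 * cQ / 3) := mul_le_mul hsq hΓ hΓ0 (by positivity)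
    _ = 4 * (cη + cQ) ^ 2 * (1 + 8 * cQ / 3) / P ^ 6 := by field_simp; ring
    _ ≤ 4 * (cη + cQ) ^ 2 * (1 + 8 * cQ / 3) / P ^ 5 :=
        div_le_div_of_nonneg_left (by positivity) (by positivity) (pow_le_pow_right₀ hP1 (by norm_num))

/-! ### §3 Brick 140b with `D` natural -/

/-- **`ε_B ≤ ¼`, `ε_C ≤ ¼`, `q₀, q₁ ≤ ½` (brick 140b `epsBC_numerics`) with `D : ℕ`** — the powers `(4/3)^D` are monoid powers, as in brick 137's
`ε_B`/`ε_C`, so the conclusion can be `exact`ed into brick 137/137b. [cite: RollinRoss2010, §4.1 Thm 4.2 (the variance scale)] -/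
theorem epsBC_numerics_nat {β cΓ cq cr : ℝ} (hβ : 0 < β) (hcΓ : 0 ≤ cΓ) (hcq : 0 ≤ cq) (hcr : 0 < cr) :
    ∃ Pstar : ℝ, 0 ≤ Pstar ∧ ∀ P : ℝ, Pstar ≤ P → 1 ≤ P →
      ∀ (D : ℕ) (Γ₀ Γ₁ q₀ q₁ m s n a LB T₀ T₁ r : ℝ),
        0 ≤ Γ₀ → Γ₀ ≤ cΓ * P → 0 ≤ Γ₁ → Γ₁ ≤ cΓ * P → 0 ≤ q₀ → q₀ ≤ cq / P ^ 6 → 0 ≤ q₁ → q₁ ≤ cq / P ^ 6 →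
        0 ≤ m → m ≤ P ^ 8 → β * P ^ 8 ≤ s → s ≤ P ^ 8 → n = 2 * P ^ 8 → (D : ℝ) ≤ 2 * P ^ 2 → 0 ≤ a → a ≤ P ^ 8 →
        0 < LB → 0 ≤ T₁ → T₁ ≤ T₀ → (D : ℝ) * (4 / 3 : ℝ) ^ D * T₀ ≤ LB / (2 * P ^ 9) → cr * P ^ 4 ≤ r →
      (m * (Γ₁ * (2 * q₁ + 3 * (D : ℝ) / s) + 2 * Γ₀ * q₀) +
          (D : ℝ) * (4 / 3 : ℝ) ^ D * ((2 * s / n + 4 * (D : ℝ) / n) * (a * T₁) + m * T₀) / LB) / r ≤ 1 / 4 ∧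
      2 * Γ₀ * q₀ + (D : ℝ) * (4 / 3 : ℝ) ^ D * T₀ / LB ≤ 1 / 4 ∧ q₀ ≤ 1 / 2 ∧ q₁ ≤ 1 / 2 := by
  obtain ⟨Pstar, hP0, h⟩ := epsBC_numerics hβ hcΓ hcq hcr
  refine ⟨Pstar, hP0, fun P hP hP1 D Γ₀ Γ₁ q₀ q₁ m s n a LB T₀ T₁ r hΓ₀0 hΓ₀ hΓ₁0 hΓ₁ hq₀0 hq₀ hq₁0 hq₁ hm0 hm hs hs' hn hD ha0 ha
    hLB hT₁0 hT₁ hfar hr => ?_⟩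
  have hfar' : (D : ℝ) * (4 / 3 : ℝ) ^ (D : ℝ) * T₀ ≤ LB / (2 * P ^ 9) := by rwa [Real.rpow_natCast]
  have key := h P hP hP1 Γ₀ Γ₁ q₀ q₁ m s n (D : ℝ) a LB T₀ T₁ r hΓ₀0 hΓ₀ hΓ₁0 hΓ₁ hq₀0 hq₀ hq₁0 hq₁ hm0 hm hs hs' hn (Nat.cast_nonneg D) hD
    ha0 ha hLB hT₁0 hT₁ hfar' hr
  simpa only [Real.rpow_natCast] using key

end Summit.PneNP.PneNP.Theorems.ChebyshevTracialDesignGammaDirectionNumericsA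

end
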